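/-
Copyright (c) 2026 the pub-hodgecm-mathlib formalisation cell (harness21).  Prover seat hodgecm-mathlib-F0P2-p11 (g3): Track B «K2-LIT»,
hLiu418 = stmt-HodgeConjecture-24832; LEAD F0P6-plan (g14∕g15) BATCH #155 (1) «(K1a-3) ∕ D-2 `hWfac`», line lead K2E5-p16 (g8); offer (A) 2026-09-05T00:31:47Z.
The BALL ∕ VALUE edition of ★ p863501 `K2LiuKindOneSingularLocalFace` (LH4-p07 (g11)): the same transport, run over ★ p863537 ∕ p863539 (this seat).
-/
import Summits.HodgeConjecture.HodgeConjecture.Theorems.K2LiuKindOneSingularLocalFace         -- ★ p863501 (LH4-p07): the transport letters (Levi shift, character reading, subgroup equality)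
import Summits.HodgeConjecture.HodgeConjecture.Theorems.K2LiuRankOneStageChainValues          -- ★ p863537 (this seat): non-split chain values
import Summits.HodgeConjecture.HodgeConjecture.Theorems.K2LiuRankOneStageChainValuesSplit     -- ★ p863539 (this seat): split chain values
import HarnessLib

/-!
# Crux `HLiu418`, socket #41 KIND 1 a♮ ∕ #42S BLOCK D — `K2LiuKindOneSingularLocalFaceBall`: THE K1 TWISTED LOCAL FACE WITH ITS BALL AND VALUE DATA, in ★ G1's currency
# `∫_{N_Δ(L⁺_v)} conj ψ_{S♭}(ι_v y)·G_s((w_Δ)_v y h) dν(y) = Gn(s, h)`, `Gn` regular on `{0 < re}`, AND `Gn(s₀, h) = cW(s₀)·∫_{x ∈ 𝔭_v^{−k}} conj ψ_{L⁺,v}((−τ_v)x)·N₂ s₀ (φ(w₂)φ(u_{2e₂}(ι x δ_L))h) dμF`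
# for all large `k`, every `s₀` with `0 < re s₀` — the D-2 letters `cW V hWfac` of ★ p862742 ∕ ★ p863475 at the assembler's OWN place letter, one `obtain` per place

Cell `hodgecm-mathlib`, crux item hLiu418 = `stmt-HodgeConjecture-24832`, route `HCCMUnconditional`; squad K2 ∕ K2Liu, LEAD F0P6-plan (g15); desk K2E5-p16 (g8).
THEOREMS ONLY (no `def`, no instance, no notation, no named-fact hypothesis, no `sorry`); lane `--supports stmt-HodgeConjecture-24832 --as helper` (count-neutral helper).

THE POINT.  ★ p863501 (LH4-p07) produces, per finite place `v`, the place letters `(Gn, hGn, hW)` of the (K1a-♮) assembler ★ p863286 ∕ ★ p863404 from ★ p29 ∕ ★ LH4-p10 —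
`Gn` ∃-opaque; #42S BLOCK D's row D-2 (★ p863475, ★ p863507) wants for THAT `Gn` the ball letters `cW V hWfac` (`Gn(½, h) = cW·V k` for all large `k`, `V k` a ball integral;
then K2Liu-p12's ★ p863521 `hV` over the same `V`).  THIS FILE re-runs ★ p863501's three transports (§1 place-class dispatch + Levi shift `w_Δ = m₀·φ(w_Δ^J)`; §2 the CM
frame of ★ `exists_adaptedFrame_eq` + the corner-character reading `conj ψ_{S♭}(ι_v u) = conj ψ_{L⁺,v}((−τ_v)·b₁(u))`; §3 `unipDeltaLoc = unipDeltaLocal`,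
`(w_Δ)_v = evalPlace v (finPart w_Δ)`) over THIS SEAT's chain-values heads ★ p863537 (non-split) ∕ ★ p863539 (split), exporting besides p863501's two clauses VERBATIM:
`cW(s)` (`= χ_s(m₀)·c_N·L_F(2s+1,χ_F)_v·∏_{w∣v} L_{E_w}(2s,χ_F∘N)`, `q_v`-regular on `0 < re s`), the stage families `N₁ N₂` (regular at every `s₀`; `N₁` by value on
`re s > −½`), and **the ball clause `Gn s₀ h = cW s₀ · ∫_{x ∈ 𝔭^{−k}} conj ψ(σx)·N₂ s₀ (φ(w₂)φ(u_{2e₂}(ι x δ)) h) dμF`, `k ≥ k₀(h)`, every `0 < re s₀`** — in §2∕§3 with the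
frame `(Q, hQ)` ∃-quantified and `ψ = ψ_{L⁺,v}`, `σ = −τ_v`, `τ = t₁·Tr(σ♭·δ_L)`.  The head **`exists_localFace_kindOneSingular_ball`** is the drop-in for ★ p863501 §3 with
`cW V hWfac` attached (`V X h i v k := ∫_{𝔭_v^{−k}} conj ψ_{L⁺,v}((−τ_v)x)·N₂(½)(…) dμF` = K2Liu-p12's `hVdef′` shape, `N₂val := x ↦ N₂(½)(φ(w₂)φ(u_{2e₂}(ιxδ_L))h)`).  The
short-root provenance (e′) of `N₂` is place-type dependent and stays in ★ p863537 ∕ p863539.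
HONEST LABEL.  Count-neutral helper; `HC_CM` is proved only modulo the 7 printed citations (2 remaining named inputs: hLiu418 = `stmt-HodgeConjecture-24832`,
h413 = `stmt-HodgeConjecture-24833`) until rung 0 closes.

## References
* [KudlaRallis1994] S. Kudla, S. Rallis, Ann. of Math. 140 (1994): §2.   * [KudlaSweet1997] S. Kudla, W. J. Sweet, Israel J. Math. 98 (1997): §1.
* [HarrisKudlaSweet1996] M. Harris, S. Kudla, W. J. Sweet, J. AMS 9 (1996): §6 (6.14)–(6.16).   * [Casselman1980] W. Casselman, Compositio Math. 40 (1980): §3 Thm. 3.1.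
* [CasselmanShalika1980] W. Casselman, J. Shalika, Compositio Math. 41 (1980), §2.
-/

set_option autoImplicit false
set_option linter.dupNamespace false -- the mandated namespace repeats `HodgeConjecture.HodgeConjecture`

noncomputable section

open scoped Classical NNReal ENNReal ComplexConjugate
open NumberField IsDedekindDomain Matrix MeasureTheory Topology Literature.NumberTheory.GaloisRepresentations.IsNonarchimedeanLocalField
open Literature.NumberTheory.Automorphic Literature.NumberTheory.Automorphic.UnitaryGroup Literature.NumberTheory.GaloisRepresentations
open Literature.NumberTheory.GelbartRogawski1991 Literature.NumberTheory.GelbartRogawski1991.GRConstruction Literature.NumberTheory.GelbartRogawski1991.AdaptedBlocks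
open Literature.NumberTheory.GelbartRogawski1991.UnitaryDualPair Literature.NumberTheory.GelbartRogawski1991.UnitaryDualPair.LocalSplitting
open Literature.NumberTheory.K2Lit Literature.NumberTheory.K2Lit.SiegelDoubled Literature.NumberTheory.K2Lit.LocalSiegelDoubled
open Summit.HodgeConjecture.HodgeConjecture.Cruxes.HLiu418.K2LiuQRationalDefs
open Summit.HodgeConjecture.HodgeConjecture.Cruxes.HLiu418.K2LiuLocalSiegelIwasawaFrame Summit.HodgeConjecture.HodgeConjecture.Cruxes.HLiu418.K2LiuLocalSiegelIwasawa Summit.HodgeConjecture.HodgeConjecture.Cruxes.HLiu418.K2LiuDoubledUTwoTwoBorelFrame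
open Summit.HodgeConjecture.HodgeConjecture.Cruxes.HLiu418.K2LiuDoubledUTwoTwoWeylCocycle Summit.HodgeConjecture.HodgeConjecture.Cruxes.HLiu418.K2LiuDoubledUTwoTwoLevi Summit.HodgeConjecture.HodgeConjecture.Cruxes.HLiu418.K2LiuDoubledUTwoTwoFrameTransport Summit.HodgeConjecture.HodgeConjecture.Cruxes.HLiu418.K2LiuDoubledUTwoTwoUnipotentHaar
open Summit.HodgeConjecture.HodgeConjecture.Cruxes.HLiu418.K2LiuUnipDeltaRankOneCoordinates (conjLocal_coord)
open Summit.HodgeConjecture.HodgeConjecture.Cruxes.HLiu418.K2LiuSiegelIntertwiningCocycle Summit.HodgeConjecture.HodgeConjecture.Cruxes.HLiu418.K2LiuFlatSiegelFamilies Summit.HodgeConjecture.HodgeConjecture.Cruxes.HLiu418.K2LiuLocalRingPlaceDecomposition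
open Summit.HodgeConjecture.HodgeConjecture.Cruxes.HLiu418.K2LiuRankOneStageChainValues (twistedRankOneChain_of_forall_eq)
open Summit.HodgeConjecture.HodgeConjecture.Cruxes.HLiu418.K2LiuRankOneStageChainValuesSplit (twistedRankOneChain_of_pair)
open Summit.HodgeConjecture.HodgeConjecture.Cruxes.HLiu418.K2LiuQRationalLFactor Summit.HodgeConjecture.HodgeConjecture.Cruxes.HLiu418.K2LiuLocalLFactorDefs
open Summit.HodgeConjecture.HodgeConjecture.Cruxes.HLiu418.K2LiuRankOneCornerCharacterReading
  (exists_adaptedFrame_eq conj_unipDeltaChar_single_locToAdelic_frameConj_nSiegel)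
open Summit.HodgeConjecture.HodgeConjecture.Cruxes.HLiu418.K2LiuSiegelUnipotentLocalDefs (unipDeltaLoc)
open Summit.HodgeConjecture.HodgeConjecture.Cruxes.HLiu418.K2LiuSiegelUnipotentFourierDefs Summit.HodgeConjecture.HodgeConjecture.Cruxes.HLiu418.K2LiuSiegelUnipotentCharacters
open Summit.HodgeConjecture.HodgeConjecture.Cruxes.HLiu418.K2LiuUnipDeltaLocBridge (unipDeltaLoc_eq_unipDeltaLocal)
open Summit.HodgeConjecture.HodgeConjecture.Cruxes.HLiu418.K2LiuLocalWhittakerFactorSkew (evalPlace_finPart_weylDelta)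

namespace Summit.HodgeConjecture.HodgeConjecture.Cruxes.HLiu418.K2LiuKindOneSingularLocalFaceBall

/-! ## §1 Generic doubled datum, any Δ-adapted frame: the twisted integral against `w_Δ` with its ball ∕ value data (both place classes) -/

section EveryPlace

variable (F : Type) [Field F] [NumberField F] (E : Type) [Field E] [NumberField E] [Algebra F E]
  [Algebra.IsQuadraticExtension F E] (c : E ≃ₐ[F] E)
  {δ : E} (hcδ : c δ = -δ) (hδ : δ ≠ 0) {d : F} (hd : δ * δ = algebraMap F E d) (v : HeightOneSpectrum (𝓞 F))
  {T₂ : Matrix (Fin 2) (Fin 2) F} (hT₂ : T₂.IsSymm) {J₂D : Matrix (Fin (2 + 2)) (Fin (2 + 2)) E} (hJ₂D : J₂D = (gramD F 2 T₂).map (algebraMap F E))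
  (D Dinv : Matrix (Fin 2) (Fin 2) F) (hDD : D * Dinv = 1) (hDD' : Dinv * D = 1) (Q : GL (Fin (2 + 2)) F)
  (hQm : (Q : Matrix (Fin (2 + 2)) (Fin (2 + 2)) F) = Matrix.reindex (e₂ 2) (e₂ 2) (Matrix.fromBlocks 1 D 1 (-D)))
  (hQ : (Q : Matrix (Fin (2 + 2)) (Fin (2 + 2)) F)ᵀ * gramD F 2 T₂ * (Q : Matrix (Fin (2 + 2)) (Fin (2 + 2)) F) = (StdForm.antidiagonal (2 + 2)).over F)

  [MeasurableSpace (v.adicCompletion F)] [BorelSpace (v.adicCompletion F)]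

set_option maxHeartbeats 400000 in -- as ★ p863501 §1 (one `placesOver_cases'` dispatch + the Levi shift; no search tactics)
include hcδ hδ hd hT₂ hDD hQm hQ in
/-- **§1 — THE TWISTED BIG-CELL INTEGRAL AGAINST `w_Δ`, WITH BALL ∕ VALUE DATA, AT EVERY FINITE PLACE.**  Binders = ★ p863501 `twistedRegularity_allPlaces` VERBATIM + a Haar
`μF` on `F_v`; conclusion = p863501's two clauses ∧ `cW` (`q_v`-regular on `0 < re s`), `N₁ N₂` (regular everywhere), `N₁` by value on `re s > −½`, and
`Gn s₀ h = cW s₀ · ∫_{x ∈ 𝔭^{−k}} conj ψ(σx)·N₂ s₀ (φ(w₂)φ(u_{2e₂}(ι x δ)) h) dμF` (`k ≥ k₀(h)`, `0 < re s₀`) — ★ p863537 ∕ ★ p863539 over ★ `placesOver_cases'`, then the Levi shift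
(`cW := χ_s(m₀)·c_N·L_F(2s+1)·L(2s)`, ★ B2 `isQRationalRegularAt_localSiegelCharacter`). [cite: KudlaRallis1994, §2] [cite: KudlaSweet1997, §1] [cite: HarrisKudlaSweet1996, §6 (6.14)–(6.16)] -/
theorem twistedRegularity_allPlaces_ball
    [MeasurableSpace (unipDeltaLocal F E c v 2 (JD := J₂D))] [BorelSpace (unipDeltaLocal F E c v 2 (JD := J₂D))]
    (νN : Measure (unipDeltaLocal F E c v 2 (JD := J₂D))) [νN.IsHaarMeasure]
    (χv : ∀ w : PlacesOver E v, (w.1.adicCompletion E)ˣ →* ℂˣ) (hχ : ∀ (w' : PlacesOver E v) (x : (w'.1.adicCompletion E)ˣ), ‖((χv w' x : ℂˣ) : ℂ)‖ = 1)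
    (K₀ : Subgroup (UnitaryGroup.localPi E c (2 + 2) J₂D v))
    (hK₀ : IsCompact (K₀ : Set (UnitaryGroup.localPi E c (2 + 2) J₂D v)) ∧ IsOpen (K₀ : Set (UnitaryGroup.localPi E c (2 + 2) J₂D v)))
    (hIw : ∀ g : UnitaryGroup.localPi E c (2 + 2) J₂D v, ∃ p, IsSiegelDelta F E c hcδ hδ hd v 2 hT₂ hJ₂D p ∧ ∃ k ∈ K₀, g = p * k)
    (f : ℂ → UnitaryGroup.localPi E c (2 + 2) J₂D v → ℂ) (hSieg : ∀ s, IsLocalSiegelSection F E c hcδ hδ hd v 2 hT₂ hJ₂D χv s (f s)) (hsm : ∀ s, IsSmooth F E c v 2 (f s))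
    (hflat : ∀ s s' : ℂ, ∀ k ∈ K₀, f s k = f s' k)
    (e3 : (v.adicCompletion F × UnitaryGroup.LocalRing E v × v.adicCompletion F) ≃ₜ unipDeltaLocal F E c v 2 (JD := J₂D))
    (he3 : ∀ b₁ z b₂, ((e3 (b₁, z, b₂) : unipDeltaLocal F E c v 2 (JD := J₂D)) : UnitaryGroup.localPi E c (2 + 2) J₂D v) =
      FrameTransport.frameConj F E c v (2 + 2) hJ₂D (antidiagonal_over_eq_map F E 2) Q hQ
        (toLocalFour F E c v (nSiegel (UnitaryGroup.LocalRing E v) (UnitaryGroup.conjLocal E c v) (UnitaryGroup.conjLocal_conjLocal c v hcδ hδ)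
          (UnitaryGroup.toLocalRing E v b₁ * algebraMap E (UnitaryGroup.LocalRing E v) δ) z
          (UnitaryGroup.toLocalRing E v b₂ * algebraMap E (UnitaryGroup.LocalRing E v) δ)
          (conjLocal_coord F E c hcδ v b₁) (conjLocal_coord F E c hcδ v b₂))))
    (he3mul : ∀ p p', e3 (p + p') = e3 p * e3 p')
    (ψ : AddChar (v.adicCompletion F) Circle) (hψ : Continuous ψ) {mψ : ℤ} (hmψ : ψ.HasConductorExp mψ) (σ : v.adicCompletion F) (hσ : σ ≠ 0)
    (μF : Measure (v.adicCompletion F)) [μF.IsAddHaarMeasure] :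
    ∃ Gn : ℂ → UnitaryGroup.localPi E c (2 + 2) J₂D v → ℂ,
      (∀ s₀ : ℂ, 0 < s₀.re → ∀ h, IsQRationalRegularAt (residueFieldCard (v.adicCompletion F)) s₀ (fun s => Gn s h)) ∧
      (∀ s : ℂ, 1 < s.re → ∀ h : UnitaryGroup.localPi E c (2 + 2) J₂D v,
        ∫ u, conj ((ψ (σ * (e3.symm u).1) : ℂ)) * f s (weylDelta F E c v 2 hJ₂D (T₀ := T₂) * (u : UnitaryGroup.localPi E c (2 + 2) J₂D v) * h) ∂νN = Gn s h) ∧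
      ∃ (cW : ℂ → ℂ) (N₁ N₂ : ℂ → UnitaryGroup.localPi E c (2 + 2) J₂D v → ℂ),
        (∀ s₀ : ℂ, 0 < s₀.re → IsQRationalRegularAt (residueFieldCard (v.adicCompletion F)) s₀ cW) ∧
        (∀ (s₀ : ℂ) (g : UnitaryGroup.localPi E c (2 + 2) J₂D v),
          IsQRationalRegularAt (residueFieldCard (v.adicCompletion F)) s₀ (fun s => N₁ s g) ∧ IsQRationalRegularAt (residueFieldCard (v.adicCompletion F)) s₀ (fun s => N₂ s g)) ∧
        (∀ s : ℂ, (-1 : ℝ) / 2 < s.re → ∀ g : UnitaryGroup.localPi E c (2 + 2) J₂D v,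
          Integrable (fun y => f s (FrameTransport.frameConj F E c v (2 + 2) hJ₂D (antidiagonal_over_eq_map F E 2) Q hQ (toLocalFour F E c v (weylTwo (UnitaryGroup.LocalRing E v) (UnitaryGroup.conjLocal E c v))) * FrameTransport.frameConj F E c v (2 + 2) hJ₂D (antidiagonal_over_eq_map F E 2) Q hQ (toLocalFour F E c v (uLongTwo (UnitaryGroup.LocalRing E v) (UnitaryGroup.conjLocal E c v) (UnitaryGroup.toLocalRing E v y * algebraMap E (UnitaryGroup.LocalRing E v) δ) (conjLocal_coord F E c hcδ v y))) * g)) μF ∧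
          N₁ s g = (lF F E v χv (2 * s + 1))⁻¹ * ∫ y, f s (FrameTransport.frameConj F E c v (2 + 2) hJ₂D (antidiagonal_over_eq_map F E 2) Q hQ (toLocalFour F E c v (weylTwo (UnitaryGroup.LocalRing E v) (UnitaryGroup.conjLocal E c v))) * FrameTransport.frameConj F E c v (2 + 2) hJ₂D (antidiagonal_over_eq_map F E 2) Q hQ (toLocalFour F E c v (uLongTwo (UnitaryGroup.LocalRing E v) (UnitaryGroup.conjLocal E c v) (UnitaryGroup.toLocalRing E v y * algebraMap E (UnitaryGroup.LocalRing E v) δ) (conjLocal_coord F E c hcδ v y))) * g) ∂μF) ∧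
        ∀ h : UnitaryGroup.localPi E c (2 + 2) J₂D v, ∃ k₀ : ℕ, ∀ s₀ : ℂ, 0 < s₀.re → ∀ k : ℕ, k₀ ≤ k →
          Gn s₀ h = cW s₀ * ∫ x in primePowBall (v.adicCompletion F) (-(k : ℤ)), conj ((ψ (σ * x) : ℂ)) * N₂ s₀ (FrameTransport.frameConj F E c v (2 + 2) hJ₂D (antidiagonal_over_eq_map F E 2) Q hQ (toLocalFour F E c v (weylTwo (UnitaryGroup.LocalRing E v) (UnitaryGroup.conjLocal E c v))) * FrameTransport.frameConj F E c v (2 + 2) hJ₂D (antidiagonal_over_eq_map F E 2) Q hQ (toLocalFour F E c v (uLongTwo (UnitaryGroup.LocalRing E v) (UnitaryGroup.conjLocal E c v) (UnitaryGroup.toLocalRing E v x * algebraMap E (UnitaryGroup.LocalRing E v) δ) (conjLocal_coord F E c hcδ v x))) * h) ∂μF := by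
  haveI : ∀ w' : PlacesOver E v, SecondCountableTopology (w'.1.adicCompletion E) := fun w' => secondCountableTopology_adicCompletion E w'.1
  have hq0 : residueFieldCard (v.adicCompletion F) ≠ 0 := residueFieldCard_ne_zero _
  -- the chain values at the frame's Weyl element `φ(w_Δ^J)`, per place class, packed place-class-free
  obtain ⟨Gn', hreg', hval', cW', N₁, N₂, hcW', hNreg, hA, hball'⟩ : ∃ (Gn' : ℂ → UnitaryGroup.localPi E c (2 + 2) J₂D v → ℂ),
      (∀ s₀ : ℂ, 0 < s₀.re → ∀ h, IsQRationalRegularAt (residueFieldCard (v.adicCompletion F)) s₀ (fun s => Gn' s h)) ∧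
      (∀ s : ℂ, 1 < s.re → ∀ h : UnitaryGroup.localPi E c (2 + 2) J₂D v,
        ∫ u, conj ((ψ (σ * (e3.symm u).1) : ℂ)) * f s (FrameTransport.frameConj F E c v (2 + 2) hJ₂D (antidiagonal_over_eq_map F E 2) Q hQ
          (toLocalFour F E c v (weylSiegel (UnitaryGroup.LocalRing E v) (UnitaryGroup.conjLocal E c v))) * (u : UnitaryGroup.localPi E c (2 + 2) J₂D v) * h) ∂νN =
          Gn' s h) ∧
      ∃ (cW : ℂ → ℂ) (N₁ N₂ : ℂ → UnitaryGroup.localPi E c (2 + 2) J₂D v → ℂ),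
        (∀ s₀ : ℂ, 0 < s₀.re → IsQRationalRegularAt (residueFieldCard (v.adicCompletion F)) s₀ cW) ∧
        (∀ (s₀ : ℂ) (g : UnitaryGroup.localPi E c (2 + 2) J₂D v),
          IsQRationalRegularAt (residueFieldCard (v.adicCompletion F)) s₀ (fun s => N₁ s g) ∧ IsQRationalRegularAt (residueFieldCard (v.adicCompletion F)) s₀ (fun s => N₂ s g)) ∧
        (∀ s : ℂ, (-1 : ℝ) / 2 < s.re → ∀ g : UnitaryGroup.localPi E c (2 + 2) J₂D v,
          Integrable (fun y => f s (FrameTransport.frameConj F E c v (2 + 2) hJ₂D (antidiagonal_over_eq_map F E 2) Q hQ (toLocalFour F E c v (weylTwo (UnitaryGroup.LocalRing E v) (UnitaryGroup.conjLocal E c v))) * FrameTransport.frameConj F E c v (2 + 2) hJ₂D (antidiagonal_over_eq_map F E 2) Q hQ (toLocalFour F E c v (uLongTwo (UnitaryGroup.LocalRing E v) (UnitaryGroup.conjLocal E c v) (UnitaryGroup.toLocalRing E v y * algebraMap E (UnitaryGroup.LocalRing E v) δ) (conjLocal_coord F E c hcδ v y))) * g)) μF ∧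
          N₁ s g = (lF F E v χv (2 * s + 1))⁻¹ * ∫ y, f s (FrameTransport.frameConj F E c v (2 + 2) hJ₂D (antidiagonal_over_eq_map F E 2) Q hQ (toLocalFour F E c v (weylTwo (UnitaryGroup.LocalRing E v) (UnitaryGroup.conjLocal E c v))) * FrameTransport.frameConj F E c v (2 + 2) hJ₂D (antidiagonal_over_eq_map F E 2) Q hQ (toLocalFour F E c v (uLongTwo (UnitaryGroup.LocalRing E v) (UnitaryGroup.conjLocal E c v) (UnitaryGroup.toLocalRing E v y * algebraMap E (UnitaryGroup.LocalRing E v) δ) (conjLocal_coord F E c hcδ v y))) * g) ∂μF) ∧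
        ∀ h : UnitaryGroup.localPi E c (2 + 2) J₂D v, ∃ k₀ : ℕ, ∀ s₀ : ℂ, 0 < s₀.re → ∀ k : ℕ, k₀ ≤ k →
          Gn' s₀ h = cW s₀ * ∫ x in primePowBall (v.adicCompletion F) (-(k : ℤ)), conj ((ψ (σ * x) : ℂ)) * N₂ s₀ (FrameTransport.frameConj F E c v (2 + 2) hJ₂D (antidiagonal_over_eq_map F E 2) Q hQ (toLocalFour F E c v (weylTwo (UnitaryGroup.LocalRing E v) (UnitaryGroup.conjLocal E c v))) * FrameTransport.frameConj F E c v (2 + 2) hJ₂D (antidiagonal_over_eq_map F E 2) Q hQ (toLocalFour F E c v (uLongTwo (UnitaryGroup.LocalRing E v) (UnitaryGroup.conjLocal E c v) (UnitaryGroup.toLocalRing E v x * algebraMap E (UnitaryGroup.LocalRing E v) δ) (conjLocal_coord F E c hcδ v x))) * h) ∂μF := by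
    rcases placesOver_cases' F E c v hcδ hδ with ⟨w, hw⟩ | ⟨w₁, w₂, hne, hw⟩
    · borelize (w.1.adicCompletion E)
      obtain ⟨cN, Gn', N₁, N₂, hreg', hval', hNreg, hA, -, hball⟩ := twistedRankOneChain_of_forall_eq F E c hcδ hδ hd v hT₂ hJ₂D D Dinv hDD Q hQm hQ νN χv hχ K₀ hK₀ hIw
        f hSieg hsm hflat e3 he3 he3mul ψ hψ hmψ hσ w hw μF (Measure.addHaar : Measure (w.1.adicCompletion E))
      refine ⟨Gn', hreg', hval', fun s => ((cN : ℝ) : ℂ) * (lF F E v χv (2 * s + 1) * lEN F E c v χv (2 * s)), N₁, N₂, fun s₀ hs₀ => ?_, hNreg, hA, fun h => ?_⟩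
      · have h1 : IsQRationalRegularAt (residueFieldCard (v.adicCompletion F)) s₀ fun s => lF F E v χv (2 * s + 1) := by
          have h := isQRationalRegularAt_lF_affine (v := v) hχ 2 (1 : ℂ) (s₀ := s₀)
            (by simp only [Nat.cast_ofNat, Complex.add_re, Complex.mul_re, Complex.re_ofNat, Complex.im_ofNat, Complex.one_re]; linarith)
          simpa only [Nat.cast_ofNat] using h
        have h2 : IsQRationalRegularAt (residueFieldCard (v.adicCompletion F)) s₀ fun s => lEN F E c v χv (2 * s) := by
          have h := isQRationalRegularAt_lEN_affine c (v := v) hχ 2 (0 : ℂ) (s₀ := s₀)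
            (by simp only [Nat.cast_ofNat, Complex.add_re, Complex.mul_re, Complex.re_ofNat, Complex.im_ofNat, Complex.zero_re]; linarith)
          simpa only [Nat.cast_ofNat, add_zero] using h
        exact (h1.mul h2).const_mul _
      · obtain ⟨k₀, hk₀⟩ := hball h
        exact ⟨k₀, fun s₀ _ k hk => by rw [hk₀ s₀ k hk]; ring⟩
    · borelize (w₁.1.adicCompletion E) (w₂.1.adicCompletion E)
      obtain ⟨cN, Gn', N₁, N₂, hreg', hval', hNreg, hA, -, hball⟩ := twistedRankOneChain_of_pair F E c hcδ hδ hd v hT₂ hJ₂D D Dinv hDD Q hQm hQ νN χv hχ K₀ hK₀ hIw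
        f hSieg hsm hflat w₁ w₂ hne hw e3 he3 ψ hmψ σ hσ μF (Measure.addHaar : Measure (w₁.1.adicCompletion E)) (Measure.addHaar : Measure (w₂.1.adicCompletion E))
      refine ⟨Gn', hreg', hval', fun s => ((cN : ℝ) : ℂ) * lF F E v χv (2 * s + 1) * lFactor E w₂.1 (chiNorm F E c v χv w₂) (2 * s) * lFactor E w₁.1 (chiNorm F E c v χv w₁) (2 * s),
        N₁, N₂, fun s₀ hs₀ => ?_, hNreg, hA, fun h => ?_⟩
      · have h1 : IsQRationalRegularAt (residueFieldCard (v.adicCompletion F)) s₀ fun s => lF F E v χv (2 * s + 1) := by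
          have h := isQRationalRegularAt_lF_affine (v := v) hχ 2 (1 : ℂ) (s₀ := s₀)
            (by simp only [Nat.cast_ofNat, Complex.add_re, Complex.mul_re, Complex.re_ofNat, Complex.im_ofNat, Complex.one_re]; linarith)
          simpa only [Nat.cast_ofNat] using h
        have h2s₀ : 0 < (((2 : ℕ) : ℂ) * s₀ + 0).re := by simp; linarith
        have h2 : IsQRationalRegularAt (residueFieldCard (v.adicCompletion F)) s₀ fun s => lFactor E w₂.1 (chiNorm F E c v χv w₂) (2 * s) := by
          have h := isQRationalRegularAt_of_placesOver (F := F) (E := E) (v := v) w₂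
            (isQRationalRegularAt_lFactor_affine (norm_unramValue_le_one (norm_chiNorm_eq_one (F := F) (E := E) (c := c) hχ w₂)) 2 0 h2s₀)
          simpa only [Nat.cast_ofNat, add_zero] using h
        have h3 : IsQRationalRegularAt (residueFieldCard (v.adicCompletion F)) s₀ fun s => lFactor E w₁.1 (chiNorm F E c v χv w₁) (2 * s) := by
          have h := isQRationalRegularAt_of_placesOver (F := F) (E := E) (v := v) w₁
            (isQRationalRegularAt_lFactor_affine (norm_unramValue_le_one (norm_chiNorm_eq_one (F := F) (E := E) (c := c) hχ w₁)) 2 0 h2s₀)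
          simpa only [Nat.cast_ofNat, add_zero] using h
        exact (((isQRationalRegularAt_const _ _ _).mul h1).mul h2).mul h3
      · obtain ⟨k₀, hk₀⟩ := hball h
        exact ⟨k₀, fun s₀ _ k hk => by rw [hk₀ s₀ k hk]⟩
  -- the Levi shift `w_Δ = m₀ · φ(w_Δ^J)`, `m₀ ∈ P_Δ(F_v)`
  have hp₀ := isSiegelDelta_weylDelta_mul_frameConj_weylSiegel F E c hcδ hδ hd v hT₂ hJ₂D D Dinv hDD Q hQm hQ
  refine ⟨fun s h => localSiegelCharacter F E c v 2 χv s (weylDelta F E c v 2 hJ₂D (T₀ := T₂) *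
      FrameTransport.frameConj F E c v (2 + 2) hJ₂D (antidiagonal_over_eq_map F E 2) Q hQ (toLocalFour F E c v (weylSiegel (UnitaryGroup.LocalRing E v) (UnitaryGroup.conjLocal E c v)))) *
      Gn' s h, fun s₀ hs₀ h => (isQRationalRegularAt_localSiegelCharacter F E c hcδ hδ hd v 2 hT₂ hJ₂D χv hp₀ s₀).mul (hreg' s₀ hs₀ h), fun s hs h => ?_,
    fun s => localSiegelCharacter F E c v 2 χv s (weylDelta F E c v 2 hJ₂D (T₀ := T₂) *
      FrameTransport.frameConj F E c v (2 + 2) hJ₂D (antidiagonal_over_eq_map F E 2) Q hQ (toLocalFour F E c v (weylSiegel (UnitaryGroup.LocalRing E v) (UnitaryGroup.conjLocal E c v)))) * cW' s,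
    N₁, N₂, fun s₀ hs₀ => (isQRationalRegularAt_localSiegelCharacter F E c hcδ hδ hd v 2 hT₂ hJ₂D χv hp₀ s₀).mul (hcW' s₀ hs₀), hNreg, hA, fun h => ?_⟩
  · show _ = localSiegelCharacter F E c v 2 χv s (weylDelta F E c v 2 hJ₂D (T₀ := T₂) *
        FrameTransport.frameConj F E c v (2 + 2) hJ₂D (antidiagonal_over_eq_map F E 2) Q hQ (toLocalFour F E c v (weylSiegel (UnitaryGroup.LocalRing E v) (UnitaryGroup.conjLocal E c v)))) *
        Gn' s h
    rw [← hval' s hs h, ← integral_const_mul]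
    refine integral_congr_ae (Filter.Eventually.of_forall fun u => ?_)
    have key : f s (weylDelta F E c v 2 hJ₂D (T₀ := T₂) * (u : UnitaryGroup.localPi E c (2 + 2) J₂D v) * h) =
        localSiegelCharacter F E c v 2 χv s (weylDelta F E c v 2 hJ₂D (T₀ := T₂) *
            FrameTransport.frameConj F E c v (2 + 2) hJ₂D (antidiagonal_over_eq_map F E 2) Q hQ (toLocalFour F E c v (weylSiegel (UnitaryGroup.LocalRing E v) (UnitaryGroup.conjLocal E c v)))) *
          f s (FrameTransport.frameConj F E c v (2 + 2) hJ₂D (antidiagonal_over_eq_map F E 2) Q hQ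
            (toLocalFour F E c v (weylSiegel (UnitaryGroup.LocalRing E v) (UnitaryGroup.conjLocal E c v))) * (u : UnitaryGroup.localPi E c (2 + 2) J₂D v) * h) := by
      conv_lhs => rw [weylDelta_eq_mul_frameConj_weylSiegel F E c v hJ₂D Q hQ]
      rw [mul_assoc, mul_assoc, (hSieg s) _ hp₀, ← mul_assoc]
    show conj ((ψ (σ * (e3.symm u).1) : ℂ)) * f s (weylDelta F E c v 2 hJ₂D (T₀ := T₂) * (u : UnitaryGroup.localPi E c (2 + 2) J₂D v) * h) = _
    rw [key]
    ring
  · -- the ball clause picks up the Levi-shift character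
    obtain ⟨k₀, hk₀⟩ := hball' h
    refine ⟨k₀, fun s₀ hs₀ k hk => ?_⟩
    show localSiegelCharacter F E c v 2 χv s₀ _ * Gn' s₀ h = _
    rw [hk₀ s₀ hs₀ k hk, mul_assoc]

end EveryPlace

/-! ## §2 The CM datum: ★ G1's character `conj ψ_{single 1 1 σ}(ι_v u)` read in the adapted frame, on `unipDeltaLocal` — with the ball ∕ value data (frame ∃-quantified) -/

section CM

variable (L : Type) [Field L] [NumberField L] [IsCMField L] {N M : ℕ} (e : Fin N × Fin M ≃ Fin 2)
  (dV : Fin N → L) (hdV : ∀ i, IsCMField.complexConj L (dV i) = dV i) (hdV0 : ∀ i, dV i ≠ 0)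
  (dW : Fin M → L) (hdW : ∀ i, IsCMField.complexConj L (dW i) = dW i) (hdW0 : ∀ i, dW i ≠ 0)
  (v : HeightOneSpectrum (𝓞 (Fp L)))

  [MeasurableSpace (v.adicCompletion (Fp L))] [BorelSpace (v.adicCompletion (Fp L))]

set_option maxHeartbeats 1600000 in -- MEASURED class of ★ p863501 §2 (the K2Lit CM telescope of ★ `exists_homeomorph_coordTwo`'s nested `frameConj (toLocalFour (nSiegel …))` terms)
include hdV0 hdW0 in
/-- **§2 — THE K1 TWISTED LOCAL FACE ON `unipDeltaLocal`, CM DATUM, WITH BALL ∕ VALUE DATA.**  Binders = ★ p863501 `twistedLocalFace_unipDeltaLocal` VERBATIM + `μF`;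
conclusion = its two clauses ∧ — over the ∃-quantified frame `(Q, hQ)` of ★ `exists_adaptedFrame_eq` — `cW N₁ N₂` as in §1 at `ψ := ψ_{L⁺,v}`, `σ := −τ_v`
(`τ = t₁·Tr_{L∕L⁺}(σ·δ_L)`; integrand converted by ★ `conj_unipDeltaChar_single_locToAdelic_frameConj_nSiegel`). [cite: KudlaRallis1994, §2] [cite: KudlaSweet1997, §1] -/
theorem twistedLocalFace_unipDeltaLocal_ball
    [MeasurableSpace (unipDeltaLocal (Fp L) L (IsCMField.complexConj L) v 2 (JD := hermD L e dV hdV dW hdW))]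
    [BorelSpace (unipDeltaLocal (Fp L) L (IsCMField.complexConj L) v 2 (JD := hermD L e dV hdV dW hdW))]
    (νN : Measure (unipDeltaLocal (Fp L) L (IsCMField.complexConj L) v 2 (JD := hermD L e dV hdV dW hdW))) [νN.IsHaarMeasure]
    (χv : ∀ w : PlacesOver L v, (w.1.adicCompletion L)ˣ →* ℂˣ) (hχ : ∀ (w' : PlacesOver L v) (x : (w'.1.adicCompletion L)ˣ), ‖((χv w' x : ℂˣ) : ℂ)‖ = 1)
    (K₀ : Subgroup (UnitaryGroup.localPi L (IsCMField.complexConj L) (2 + 2) (hermD L e dV hdV dW hdW) v))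
    (hK₀ : IsCompact (K₀ : Set (UnitaryGroup.localPi L (IsCMField.complexConj L) (2 + 2) (hermD L e dV hdV dW hdW) v)) ∧
      IsOpen (K₀ : Set (UnitaryGroup.localPi L (IsCMField.complexConj L) (2 + 2) (hermD L e dV hdV dW hdW) v)))
    (hIw : haveI : Algebra.IsQuadraticExtension (Fp L) L := IsCMField.isQuadraticExtension L
      ∀ g : UnitaryGroup.localPi L (IsCMField.complexConj L) (2 + 2) (hermD L e dV hdV dW hdW) v,
        ∃ p, IsSiegelDelta (Fp L) L (IsCMField.complexConj L) (complexConj_imagUnit L) (imagUnit_ne_zero L) (imagUnit_mul_self L)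
          v 2 (gramR_isSymm L e dV hdV dW hdW) (hermD_eq_map_gramD L e dV hdV dW hdW) p ∧ ∃ k ∈ K₀, g = p * k)
    (G : ℂ → UnitaryGroup.localPi L (IsCMField.complexConj L) (2 + 2) (hermD L e dV hdV dW hdW) v → ℂ)
    (hSieg : haveI : Algebra.IsQuadraticExtension (Fp L) L := IsCMField.isQuadraticExtension L
      ∀ s, IsLocalSiegelSection (Fp L) L (IsCMField.complexConj L) (complexConj_imagUnit L) (imagUnit_ne_zero L) (imagUnit_mul_self L)
        v 2 (gramR_isSymm L e dV hdV dW hdW) (hermD_eq_map_gramD L e dV hdV dW hdW) χv s (G s))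
    (hsm : ∀ s, IsSmooth (Fp L) L (IsCMField.complexConj L) v 2 (G s))
    (hflat : ∀ s s' : ℂ, ∀ k ∈ K₀, G s k = G s' k)
    (σ : L) (hτ : gramR L e dV hdV dW hdW 1 1 * Algebra.trace (Fp L) L (σ * imagUnit L) ≠ 0)
    (μF : Measure (v.adicCompletion (Fp L))) [μF.IsAddHaarMeasure] :
    ∃ Gn : ℂ → UnitaryGroup.localPi L (IsCMField.complexConj L) (2 + 2) (hermD L e dV hdV dW hdW) v → ℂ,
      (∀ s₀ : ℂ, 0 < s₀.re → ∀ h, IsQRationalRegularAt (residueFieldCard (v.adicCompletion (Fp L))) s₀ (fun s => Gn s h)) ∧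
      (∀ s : ℂ, 1 < s.re → ∀ h : UnitaryGroup.localPi L (IsCMField.complexConj L) (2 + 2) (hermD L e dV hdV dW hdW) v,
        ∫ u, conj ((unipDeltaChar L e dV hdV dW hdW (Matrix.single 1 1 σ)
              (locToAdelic L e dV hdV dW hdW v (u : UnitaryGroup.localPi L (IsCMField.complexConj L) (2 + 2) (hermD L e dV hdV dW hdW) v)) : ℂ)) *
            G s (UnitaryDualPair.LocalSplitting.weylDelta (Fp L) L (IsCMField.complexConj L) v 2 (hermD_eq_map_gramD L e dV hdV dW hdW) *
              (u : UnitaryGroup.localPi L (IsCMField.complexConj L) (2 + 2) (hermD L e dV hdV dW hdW) v) * h) ∂νN = Gn s h) ∧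
      ∃ (Q : GL (Fin (2 + 2)) (Fp L)) (hQ : (Q : Matrix (Fin (2 + 2)) (Fin (2 + 2)) (Fp L))ᵀ * gramD (Fp L) 2 (gramR L e dV hdV dW hdW) * (Q : Matrix (Fin (2 + 2)) (Fin (2 + 2)) (Fp L)) =
          (StdForm.antidiagonal (2 + 2)).over (Fp L)) (cW : ℂ → ℂ) (N₁ N₂ : ℂ → UnitaryGroup.localPi L (IsCMField.complexConj L) (2 + 2) (hermD L e dV hdV dW hdW) v → ℂ),
        (∀ s₀ : ℂ, 0 < s₀.re → IsQRationalRegularAt (residueFieldCard (v.adicCompletion (Fp L))) s₀ cW) ∧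
        (∀ (s₀ : ℂ) (g : UnitaryGroup.localPi L (IsCMField.complexConj L) (2 + 2) (hermD L e dV hdV dW hdW) v),
          IsQRationalRegularAt (residueFieldCard (v.adicCompletion (Fp L))) s₀ (fun s => N₁ s g) ∧ IsQRationalRegularAt (residueFieldCard (v.adicCompletion (Fp L))) s₀ (fun s => N₂ s g)) ∧
        (haveI : Algebra.IsQuadraticExtension (Fp L) L := IsCMField.isQuadraticExtension L
          ∀ s : ℂ, (-1 : ℝ) / 2 < s.re → ∀ g : UnitaryGroup.localPi L (IsCMField.complexConj L) (2 + 2) (hermD L e dV hdV dW hdW) v,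
          Integrable (fun y => G s (FrameTransport.frameConj (Fp L) L (IsCMField.complexConj L) v (2 + 2) (hermD_eq_map_gramD L e dV hdV dW hdW) (antidiagonal_over_eq_map (Fp L) L 2) Q hQ (toLocalFour (Fp L) L (IsCMField.complexConj L) v (weylTwo (UnitaryGroup.LocalRing L v) (UnitaryGroup.conjLocal L (IsCMField.complexConj L) v))) * FrameTransport.frameConj (Fp L) L (IsCMField.complexConj L) v (2 + 2) (hermD_eq_map_gramD L e dV hdV dW hdW) (antidiagonal_over_eq_map (Fp L) L 2) Q hQ (toLocalFour (Fp L) L (IsCMField.complexConj L) v (uLongTwo (UnitaryGroup.LocalRing L v) (UnitaryGroup.conjLocal L (IsCMField.complexConj L) v) (UnitaryGroup.toLocalRing L v y * algebraMap L (UnitaryGroup.LocalRing L v) (imagUnit L)) (conjLocal_coord (Fp L) L (IsCMField.complexConj L) (complexConj_imagUnit L) v y))) * g)) μF ∧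
          N₁ s g = (lF (Fp L) L v χv (2 * s + 1))⁻¹ * ∫ y, G s (FrameTransport.frameConj (Fp L) L (IsCMField.complexConj L) v (2 + 2) (hermD_eq_map_gramD L e dV hdV dW hdW) (antidiagonal_over_eq_map (Fp L) L 2) Q hQ (toLocalFour (Fp L) L (IsCMField.complexConj L) v (weylTwo (UnitaryGroup.LocalRing L v) (UnitaryGroup.conjLocal L (IsCMField.complexConj L) v))) * FrameTransport.frameConj (Fp L) L (IsCMField.complexConj L) v (2 + 2) (hermD_eq_map_gramD L e dV hdV dW hdW) (antidiagonal_over_eq_map (Fp L) L 2) Q hQ (toLocalFour (Fp L) L (IsCMField.complexConj L) v (uLongTwo (UnitaryGroup.LocalRing L v) (UnitaryGroup.conjLocal L (IsCMField.complexConj L) v) (UnitaryGroup.toLocalRing L v y * algebraMap L (UnitaryGroup.LocalRing L v) (imagUnit L)) (conjLocal_coord (Fp L) L (IsCMField.complexConj L) (complexConj_imagUnit L) v y))) * g) ∂μF) ∧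
        (haveI : Algebra.IsQuadraticExtension (Fp L) L := IsCMField.isQuadraticExtension L
          ∀ h : UnitaryGroup.localPi L (IsCMField.complexConj L) (2 + 2) (hermD L e dV hdV dW hdW) v, ∃ k₀ : ℕ, ∀ s₀ : ℂ, 0 < s₀.re → ∀ k : ℕ, k₀ ≤ k →
          Gn s₀ h = cW s₀ * ∫ x in primePowBall (v.adicCompletion (Fp L)) (-(k : ℤ)),
            conj ((adeleAddCharAt (Fp L) v (-(algebraMap (Fp L) (v.adicCompletion (Fp L)) (gramR L e dV hdV dW hdW 1 1 * Algebra.trace (Fp L) L (σ * imagUnit L))) * x) : ℂ)) * N₂ s₀ (FrameTransport.frameConj (Fp L) L (IsCMField.complexConj L) v (2 + 2) (hermD_eq_map_gramD L e dV hdV dW hdW) (antidiagonal_over_eq_map (Fp L) L 2) Q hQ (toLocalFour (Fp L) L (IsCMField.complexConj L) v (weylTwo (UnitaryGroup.LocalRing L v) (UnitaryGroup.conjLocal L (IsCMField.complexConj L) v))) * FrameTransport.frameConj (Fp L) L (IsCMField.complexConj L) v (2 + 2) (hermD_eq_map_gramD L e dV hdV dW hdW) (antidiagonal_over_eq_map (Fp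 L) L 2) Q hQ (toLocalFour (Fp L) L (IsCMField.complexConj L) v (uLongTwo (UnitaryGroup.LocalRing L v) (UnitaryGroup.conjLocal L (IsCMField.complexConj L) v) (UnitaryGroup.toLocalRing L v x * algebraMap L (UnitaryGroup.LocalRing L v) (imagUnit L)) (conjLocal_coord (Fp L) L (IsCMField.complexConj L) (complexConj_imagUnit L) v x))) * h) ∂μF) := by
  haveI : Algebra.IsQuadraticExtension (Fp L) L := IsCMField.isQuadraticExtension L
  -- the Δ-adapted frame with its inverse block exposed, and the unipotent coordinates in it
  obtain ⟨D, Dinv, Q, hDD, hDD', hQm, hQ, -, hDinv⟩ :=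
    exists_adaptedFrame_eq (Fp L) 2 (gramR_isSymm L e dV hdV dW hdW) (isUnit_det_gramR₀ L e dV hdV hdV0 dW hdW hdW0)
  obtain ⟨e3, he3, he3mul⟩ := exists_homeomorph_coordTwo (Fp L) L (IsCMField.complexConj L) (complexConj_imagUnit L) (imagUnit_ne_zero L) v
    (hermD_eq_map_gramD L e dV hdV dW hdW) D Dinv hDD hDD' Q hQm hQ
  -- Tate's character at `v`: continuous, with a conductor exponent
  obtain ⟨mψ, hmψ⟩ := (isGlobalAddChar_adeleAddChar (Fp L)).exists_hasConductorExp_adicComponent v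
  have hτv : -(algebraMap (Fp L) (v.adicCompletion (Fp L)) (gramR L e dV hdV dW hdW 1 1 * Algebra.trace (Fp L) L (σ * imagUnit L))) ≠ 0 :=
    neg_ne_zero.2 ((map_ne_zero _).2 hτ)
  obtain ⟨Gn, hreg, hval, cW, N₁, N₂, hcW, hNreg, hA, hball⟩ := twistedRegularity_allPlaces_ball (Fp L) L (IsCMField.complexConj L) (complexConj_imagUnit L)
    (imagUnit_ne_zero L) (imagUnit_mul_self L) v (gramR_isSymm L e dV hdV dW hdW) (hermD_eq_map_gramD L e dV hdV dW hdW) D Dinv hDD Q hQm hQ νN χv hχ K₀ hK₀ hIw G hSieg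
    hsm hflat e3 he3 he3mul (adeleAddCharAt (Fp L) v) (continuous_adeleAddCharAt (K := Fp L) (v := v)) hmψ _ hτv μF
  refine ⟨Gn, hreg, fun s hs h => ?_, Q, hQ, cW, N₁, N₂, hcW, hNreg, hA, hball⟩
  rw [← hval s hs h]
  refine integral_congr_ae (Filter.Eventually.of_forall fun u => ?_)
  -- the point `u` in coordinates, and the character read there
  have hu : (u : UnitaryGroup.localPi L (IsCMField.complexConj L) (2 + 2) (hermD L e dV hdV dW hdW) v) =
      FrameTransport.frameConj (Fp L) L (IsCMField.complexConj L) v (2 + 2) (hermD_eq_map_gramD L e dV hdV dW hdW) (antidiagonal_over_eq_map (Fp L) L 2) Q hQ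
        (toLocalFour (Fp L) L (IsCMField.complexConj L) v
          (nSiegel (UnitaryGroup.LocalRing L v) (UnitaryGroup.conjLocal L (IsCMField.complexConj L) v)
            (UnitaryGroup.conjLocal_conjLocal (IsCMField.complexConj L) v (complexConj_imagUnit L) (imagUnit_ne_zero L))
            (UnitaryGroup.toLocalRing L v (e3.symm u).1 * algebraMap L (UnitaryGroup.LocalRing L v) (imagUnit L)) (e3.symm u).2.1
            (UnitaryGroup.toLocalRing L v (e3.symm u).2.2 * algebraMap L (UnitaryGroup.LocalRing L v) (imagUnit L))
            (conjLocal_coord (Fp L) L (IsCMField.complexConj L) (complexConj_imagUnit L) v (e3.symm u).1)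
            (conjLocal_coord (Fp L) L (IsCMField.complexConj L) (complexConj_imagUnit L) v (e3.symm u).2.2))) := by
    have h := he3 (e3.symm u).1 (e3.symm u).2.1 (e3.symm u).2.2
    simp only [Prod.mk.eta, Homeomorph.apply_symm_apply] at h
    exact h
  have hchar : conj ((unipDeltaChar L e dV hdV dW hdW (Matrix.single 1 1 σ)
        (locToAdelic L e dV hdV dW hdW v (u : UnitaryGroup.localPi L (IsCMField.complexConj L) (2 + 2) (hermD L e dV hdV dW hdW) v)) : ℂ)) =
      conj ((adeleAddCharAt (Fp L) v (-(algebraMap (Fp L) (v.adicCompletion (Fp L)) (gramR L e dV hdV dW hdW 1 1 * Algebra.trace (Fp L) L (σ * imagUnit L))) *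
        (e3.symm u).1) : ℂ)) := by
    rw [hu, conj_unipDeltaChar_single_locToAdelic_frameConj_nSiegel L e dV hdV dW hdW v D Dinv hDD Q hQm hQ hDinv σ, neg_mul, AddChar.map_neg_eq_inv,
      Circle.coe_inv_eq_conj, Complex.conj_conj, mul_comm]
  show conj ((unipDeltaChar L e dV hdV dW hdW (Matrix.single 1 1 σ)
        (locToAdelic L e dV hdV dW hdW v (u : UnitaryGroup.localPi L (IsCMField.complexConj L) (2 + 2) (hermD L e dV hdV dW hdW) v)) : ℂ)) * _ = _
  rw [hchar]

/-! ## §3 On the global-comap subgroup `unipDeltaLoc v` against `(w_Δ)_v = evalPlace v (finPart w_Δ)` — ★ G1's currency, with the ball ∕ value data -/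

set_option maxHeartbeats 800000 in -- MEASURED class of ★ p863501 §3 (the K2Lit CM telescope)
include hdV0 hdW0 in
/-- the `subst` step: §2 on any subgroup EQUAL to `unipDeltaLocal` (★ B1 supplies `unipDeltaLoc v = unipDeltaLocal v`). [folklore] -/
theorem twistedLocalFace_of_eq_unipDeltaLocal_ball
    {N' : Subgroup (UnitaryGroup.localPi L (IsCMField.complexConj L) (2 + 2) (hermD L e dV hdV dW hdW) v)}
    (hN' : N' = unipDeltaLocal (Fp L) L (IsCMField.complexConj L) v 2 (JD := hermD L e dV hdV dW hdW))
    [MeasurableSpace N'] [BorelSpace N'] (ν : Measure N') [ν.IsHaarMeasure]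
    (χv : ∀ w : PlacesOver L v, (w.1.adicCompletion L)ˣ →* ℂˣ) (hχ : ∀ (w' : PlacesOver L v) (x : (w'.1.adicCompletion L)ˣ), ‖((χv w' x : ℂˣ) : ℂ)‖ = 1)
    (K₀ : Subgroup (UnitaryGroup.localPi L (IsCMField.complexConj L) (2 + 2) (hermD L e dV hdV dW hdW) v))
    (hK₀ : IsCompact (K₀ : Set (UnitaryGroup.localPi L (IsCMField.complexConj L) (2 + 2) (hermD L e dV hdV dW hdW) v)) ∧
      IsOpen (K₀ : Set (UnitaryGroup.localPi L (IsCMField.complexConj L) (2 + 2) (hermD L e dV hdV dW hdW) v)))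
    (hIw : haveI : Algebra.IsQuadraticExtension (Fp L) L := IsCMField.isQuadraticExtension L
      ∀ g : UnitaryGroup.localPi L (IsCMField.complexConj L) (2 + 2) (hermD L e dV hdV dW hdW) v,
        ∃ p, IsSiegelDelta (Fp L) L (IsCMField.complexConj L) (complexConj_imagUnit L) (imagUnit_ne_zero L) (imagUnit_mul_self L)
          v 2 (gramR_isSymm L e dV hdV dW hdW) (hermD_eq_map_gramD L e dV hdV dW hdW) p ∧ ∃ k ∈ K₀, g = p * k)
    (G : ℂ → UnitaryGroup.localPi L (IsCMField.complexConj L) (2 + 2) (hermD L e dV hdV dW hdW) v → ℂ)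
    (hSieg : haveI : Algebra.IsQuadraticExtension (Fp L) L := IsCMField.isQuadraticExtension L
      ∀ s, IsLocalSiegelSection (Fp L) L (IsCMField.complexConj L) (complexConj_imagUnit L) (imagUnit_ne_zero L) (imagUnit_mul_self L)
        v 2 (gramR_isSymm L e dV hdV dW hdW) (hermD_eq_map_gramD L e dV hdV dW hdW) χv s (G s))
    (hsm : ∀ s, IsSmooth (Fp L) L (IsCMField.complexConj L) v 2 (G s))
    (hflat : ∀ s s' : ℂ, ∀ k ∈ K₀, G s k = G s' k)
    (σ : L) (hτ : gramR L e dV hdV dW hdW 1 1 * Algebra.trace (Fp L) L (σ * imagUnit L) ≠ 0)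
    (μF : Measure (v.adicCompletion (Fp L))) [μF.IsAddHaarMeasure] :
    ∃ Gn : ℂ → UnitaryGroup.localPi L (IsCMField.complexConj L) (2 + 2) (hermD L e dV hdV dW hdW) v → ℂ,
      (∀ s₀ : ℂ, 0 < s₀.re → ∀ h, IsQRationalRegularAt (residueFieldCard (v.adicCompletion (Fp L))) s₀ (fun s => Gn s h)) ∧
      (∀ s : ℂ, 1 < s.re → ∀ h : UnitaryGroup.localPi L (IsCMField.complexConj L) (2 + 2) (hermD L e dV hdV dW hdW) v,
        ∫ u : N', conj ((unipDeltaChar L e dV hdV dW hdW (Matrix.single 1 1 σ)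
              (locToAdelic L e dV hdV dW hdW v (u : UnitaryGroup.localPi L (IsCMField.complexConj L) (2 + 2) (hermD L e dV hdV dW hdW) v)) : ℂ)) *
            G s (UnitaryDualPair.LocalSplitting.weylDelta (Fp L) L (IsCMField.complexConj L) v 2 (hermD_eq_map_gramD L e dV hdV dW hdW) *
              (u : UnitaryGroup.localPi L (IsCMField.complexConj L) (2 + 2) (hermD L e dV hdV dW hdW) v) * h) ∂ν = Gn s h) ∧
      ∃ (Q : GL (Fin (2 + 2)) (Fp L)) (hQ : (Q : Matrix (Fin (2 + 2)) (Fin (2 + 2)) (Fp L))ᵀ * gramD (Fp L) 2 (gramR L e dV hdV dW hdW) * (Q : Matrix (Fin (2 + 2)) (Fin (2 + 2)) (Fp L)) =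
          (StdForm.antidiagonal (2 + 2)).over (Fp L)) (cW : ℂ → ℂ) (N₁ N₂ : ℂ → UnitaryGroup.localPi L (IsCMField.complexConj L) (2 + 2) (hermD L e dV hdV dW hdW) v → ℂ),
        (∀ s₀ : ℂ, 0 < s₀.re → IsQRationalRegularAt (residueFieldCard (v.adicCompletion (Fp L))) s₀ cW) ∧
        (∀ (s₀ : ℂ) (g : UnitaryGroup.localPi L (IsCMField.complexConj L) (2 + 2) (hermD L e dV hdV dW hdW) v),
          IsQRationalRegularAt (residueFieldCard (v.adicCompletion (Fp L))) s₀ (fun s => N₁ s g) ∧ IsQRationalRegularAt (residueFieldCard (v.adicCompletion (Fp L))) s₀ (fun s => N₂ s g)) ∧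
        (haveI : Algebra.IsQuadraticExtension (Fp L) L := IsCMField.isQuadraticExtension L
          ∀ s : ℂ, (-1 : ℝ) / 2 < s.re → ∀ g : UnitaryGroup.localPi L (IsCMField.complexConj L) (2 + 2) (hermD L e dV hdV dW hdW) v,
          Integrable (fun y => G s (FrameTransport.frameConj (Fp L) L (IsCMField.complexConj L) v (2 + 2) (hermD_eq_map_gramD L e dV hdV dW hdW) (antidiagonal_over_eq_map (Fp L) L 2) Q hQ (toLocalFour (Fp L) L (IsCMField.complexConj L) v (weylTwo (UnitaryGroup.LocalRing L v) (UnitaryGroup.conjLocal L (IsCMField.complexConj L) v))) * FrameTransport.frameConj (Fp L) L (IsCMField.complexConj L) v (2 + 2) (hermD_eq_map_gramD L e dV hdV dW hdW) (antidiagonal_over_eq_map (Fp L) L 2) Q hQ (toLocalFour (Fp L) L (IsCMField.complexConj L) v (uLongTwo (UnitaryGroup.LocalRing L v) (UnitaryGroup.conjLocal L (IsCMField.complexConj L) v) (UnitaryGroup.toLocalRing L v y * algebraMap L (UnitaryGroup.LocalRing L v) (imagUnit L)) (conjLocal_coord (Fp L) L (IsCMField.complexConj L) (complexConj_imagUnit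 L) v y))) * g)) μF ∧
          N₁ s g = (lF (Fp L) L v χv (2 * s + 1))⁻¹ * ∫ y, G s (FrameTransport.frameConj (Fp L) L (IsCMField.complexConj L) v (2 + 2) (hermD_eq_map_gramD L e dV hdV dW hdW) (antidiagonal_over_eq_map (Fp L) L 2) Q hQ (toLocalFour (Fp L) L (IsCMField.complexConj L) v (weylTwo (UnitaryGroup.LocalRing L v) (UnitaryGroup.conjLocal L (IsCMField.complexConj L) v))) * FrameTransport.frameConj (Fp L) L (IsCMField.complexConj L) v (2 + 2) (hermD_eq_map_gramD L e dV hdV dW hdW) (antidiagonal_over_eq_map (Fp L) L 2) Q hQ (toLocalFour (Fp L) L (IsCMField.complexConj L) v (uLongTwo (UnitaryGroup.LocalRing L v) (UnitaryGroup.conjLocal L (IsCMField.complexConj L) v) (UnitaryGroup.toLocalRing L v y * algebraMap L (UnitaryGroup.LocalRing L v) (imagUnit L)) (conjLocal_coord (Fp L) L (IsCMField.complexConj L) (complexConj_imagUnit L) v y))) * g) ∂μF) ∧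
        (haveI : Algebra.IsQuadraticExtension (Fp L) L := IsCMField.isQuadraticExtension L
          ∀ h : UnitaryGroup.localPi L (IsCMField.complexConj L) (2 + 2) (hermD L e dV hdV dW hdW) v, ∃ k₀ : ℕ, ∀ s₀ : ℂ, 0 < s₀.re → ∀ k : ℕ, k₀ ≤ k →
          Gn s₀ h = cW s₀ * ∫ x in primePowBall (v.adicCompletion (Fp L)) (-(k : ℤ)),
            conj ((adeleAddCharAt (Fp L) v (-(algebraMap (Fp L) (v.adicCompletion (Fp L)) (gramR L e dV hdV dW hdW 1 1 * Algebra.trace (Fp L) L (σ * imagUnit L))) * x) : ℂ)) * N₂ s₀ (FrameTransport.frameConj (Fp L) L (IsCMField.complexConj L) v (2 + 2) (hermD_eq_map_gramD L e dV hdV dW hdW) (antidiagonal_over_eq_map (Fp L) L 2) Q hQ (toLocalFour (Fp L) L (IsCMField.complexConj L) v (weylTwo (UnitaryGroup.LocalRing L v) (UnitaryGroup.conjLocal L (IsCMField.complexConj L) v))) * FrameTransport.frameConj (Fp L) L (IsCMField.complexConj L) v (2 + 2) (hermD_eq_map_gramD L e dV hdV dW hdW) (antidiagonal_over_eq_map (Fp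 L) L 2) Q hQ (toLocalFour (Fp L) L (IsCMField.complexConj L) v (uLongTwo (UnitaryGroup.LocalRing L v) (UnitaryGroup.conjLocal L (IsCMField.complexConj L) v) (UnitaryGroup.toLocalRing L v x * algebraMap L (UnitaryGroup.LocalRing L v) (imagUnit L)) (conjLocal_coord (Fp L) L (IsCMField.complexConj L) (complexConj_imagUnit L) v x))) * h) ∂μF) := by
  subst hN'
  exact twistedLocalFace_unipDeltaLocal_ball L e dV hdV hdV0 dW hdW hdW0 v ν χv hχ K₀ hK₀ hIw G hSieg hsm hflat σ hτ μF

set_option maxHeartbeats 800000 in -- MEASURED class of ★ p863501 §3 (the K2Lit CM telescope under `rw [evalPlace_finPart_weylDelta]`)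
include hdV0 hdW0 in
/-- **THE K1 TWISTED LOCAL FACE WITH ITS BALL ∕ VALUE DATA** — drop-in for ★ p863501 `exists_localFace_kindOneSingular` (same binders + `μF`; its two clauses `(hGn, hW)`
VERBATIM) PLUS, over an ∃-quantified Δ-adapted frame `(Q, hQ)`: `cW` (`q_v`-regular on `0 < re s`), `N₁ N₂` (regular everywhere; `N₁` by value on `re s > −½`) and **the ball
clause `Gn s₀ h = cW s₀ · ∫_{x ∈ 𝔭_v^{−k}} conj ψ_{L⁺,v}((−τ_v)·x)·N₂ s₀ (φ(w₂)·φ(u_{2e₂}(ι x δ_L))·h) dμF` for `k ≥ k₀(h)`, `0 < re s₀`** — at `s₀ = ½` the D-2 letters `cW V hWfac` of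
★ p863475 ∕ ★ p863507 for the assembler's OWN `Gn` (K2Liu-p12's ★ p863521 `hVdef′` shape: `N₂val X j h i v x := N₂ ½ (φ(w₂)φ(u_{2e₂}(ι x δ_L)) h_v)`, `σc X v := −τ_v`).
[cite: KudlaRallis1994, §2] [cite: KudlaSweet1997, §1] [cite: HarrisKudlaSweet1996, §6 (6.14)–(6.16)] [cite: CasselmanShalika1980, §2] -/
theorem exists_localFace_kindOneSingular_ball
    [MeasurableSpace ↥(unipDeltaLoc L e dV hdV dW hdW v)] [BorelSpace ↥(unipDeltaLoc L e dV hdV dW hdW v)] (ν : Measure ↥(unipDeltaLoc L e dV hdV dW hdW v)) [ν.IsHaarMeasure]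
    (χv : ∀ w : PlacesOver L v, (w.1.adicCompletion L)ˣ →* ℂˣ) (hχ : ∀ (w' : PlacesOver L v) (x : (w'.1.adicCompletion L)ˣ), ‖((χv w' x : ℂˣ) : ℂ)‖ = 1)
    (K₀ : Subgroup (UnitaryGroup.localPi L (IsCMField.complexConj L) (2 + 2) (hermD L e dV hdV dW hdW) v))
    (hK₀ : IsCompact (K₀ : Set (UnitaryGroup.localPi L (IsCMField.complexConj L) (2 + 2) (hermD L e dV hdV dW hdW) v)) ∧
      IsOpen (K₀ : Set (UnitaryGroup.localPi L (IsCMField.complexConj L) (2 + 2) (hermD L e dV hdV dW hdW) v)))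
    (hIw : haveI : Algebra.IsQuadraticExtension (Fp L) L := IsCMField.isQuadraticExtension L
      ∀ g : UnitaryGroup.localPi L (IsCMField.complexConj L) (2 + 2) (hermD L e dV hdV dW hdW) v,
        ∃ p, IsSiegelDelta (Fp L) L (IsCMField.complexConj L) (complexConj_imagUnit L) (imagUnit_ne_zero L) (imagUnit_mul_self L)
          v 2 (gramR_isSymm L e dV hdV dW hdW) (hermD_eq_map_gramD L e dV hdV dW hdW) p ∧ ∃ k ∈ K₀, g = p * k)
    (G : ℂ → UnitaryGroup.localPi L (IsCMField.complexConj L) (2 + 2) (hermD L e dV hdV dW hdW) v → ℂ)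
    (hSieg : haveI : Algebra.IsQuadraticExtension (Fp L) L := IsCMField.isQuadraticExtension L
      ∀ s, IsLocalSiegelSection (Fp L) L (IsCMField.complexConj L) (complexConj_imagUnit L) (imagUnit_ne_zero L) (imagUnit_mul_self L)
        v 2 (gramR_isSymm L e dV hdV dW hdW) (hermD_eq_map_gramD L e dV hdV dW hdW) χv s (G s))
    (hsm : ∀ s, IsSmooth (Fp L) L (IsCMField.complexConj L) v 2 (G s))
    (hflat : ∀ s s' : ℂ, ∀ k ∈ K₀, G s k = G s' k)
    (σ : L) (hτ : gramR L e dV hdV dW hdW 1 1 * Algebra.trace (Fp L) L (σ * imagUnit L) ≠ 0)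
    (μF : Measure (v.adicCompletion (Fp L))) [μF.IsAddHaarMeasure] :
    ∃ Gn : ℂ → UnitaryGroup.localPi L (IsCMField.complexConj L) (2 + 2) (hermD L e dV hdV dW hdW) v → ℂ,
      (∀ s₀ : ℂ, 0 < s₀.re → ∀ h, IsQRationalRegularAt (residueFieldCard (v.adicCompletion (Fp L))) s₀ (fun s => Gn s h)) ∧
      (∀ s : ℂ, 1 < s.re → ∀ h : UnitaryGroup.localPi L (IsCMField.complexConj L) (2 + 2) (hermD L e dV hdV dW hdW) v,
        ∫ y : ↥(unipDeltaLoc L e dV hdV dW hdW v), conj ((unipDeltaChar L e dV hdV dW hdW (Matrix.single 1 1 σ)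
              (locToAdelic L e dV hdV dW hdW v (y : UnitaryGroup.localPi L (IsCMField.complexConj L) (2 + 2) (hermD L e dV hdV dW hdW) v)) : ℂ)) *
            G s (UnitaryGroup.evalPlace (Fp L) L (IsCMField.complexConj L) (2 + 2) (hermD L e dV hdV dW hdW) v
                  (UnitaryGroup.finPart (Fp L) L (IsCMField.complexConj L) (2 + 2) (hermD L e dV hdV dW hdW) (SiegelDoubled.weylDelta L e dV hdV dW hdW)) *
              (y : UnitaryGroup.localPi L (IsCMField.complexConj L) (2 + 2) (hermD L e dV hdV dW hdW) v) * h) ∂ν = Gn s h) ∧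
      ∃ (Q : GL (Fin (2 + 2)) (Fp L)) (hQ : (Q : Matrix (Fin (2 + 2)) (Fin (2 + 2)) (Fp L))ᵀ * gramD (Fp L) 2 (gramR L e dV hdV dW hdW) * (Q : Matrix (Fin (2 + 2)) (Fin (2 + 2)) (Fp L)) =
          (StdForm.antidiagonal (2 + 2)).over (Fp L)) (cW : ℂ → ℂ) (N₁ N₂ : ℂ → UnitaryGroup.localPi L (IsCMField.complexConj L) (2 + 2) (hermD L e dV hdV dW hdW) v → ℂ),
        (∀ s₀ : ℂ, 0 < s₀.re → IsQRationalRegularAt (residueFieldCard (v.adicCompletion (Fp L))) s₀ cW) ∧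
        (∀ (s₀ : ℂ) (g : UnitaryGroup.localPi L (IsCMField.complexConj L) (2 + 2) (hermD L e dV hdV dW hdW) v),
          IsQRationalRegularAt (residueFieldCard (v.adicCompletion (Fp L))) s₀ (fun s => N₁ s g) ∧ IsQRationalRegularAt (residueFieldCard (v.adicCompletion (Fp L))) s₀ (fun s => N₂ s g)) ∧
        (haveI : Algebra.IsQuadraticExtension (Fp L) L := IsCMField.isQuadraticExtension L
          ∀ s : ℂ, (-1 : ℝ) / 2 < s.re → ∀ g : UnitaryGroup.localPi L (IsCMField.complexConj L) (2 + 2) (hermD L e dV hdV dW hdW) v,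
          Integrable (fun y => G s (FrameTransport.frameConj (Fp L) L (IsCMField.complexConj L) v (2 + 2) (hermD_eq_map_gramD L e dV hdV dW hdW) (antidiagonal_over_eq_map (Fp L) L 2) Q hQ (toLocalFour (Fp L) L (IsCMField.complexConj L) v (weylTwo (UnitaryGroup.LocalRing L v) (UnitaryGroup.conjLocal L (IsCMField.complexConj L) v))) * FrameTransport.frameConj (Fp L) L (IsCMField.complexConj L) v (2 + 2) (hermD_eq_map_gramD L e dV hdV dW hdW) (antidiagonal_over_eq_map (Fp L) L 2) Q hQ (toLocalFour (Fp L) L (IsCMField.complexConj L) v (uLongTwo (UnitaryGroup.LocalRing L v) (UnitaryGroup.conjLocal L (IsCMField.complexConj L) v) (UnitaryGroup.toLocalRing L v y * algebraMap L (UnitaryGroup.LocalRing L v) (imagUnit L)) (conjLocal_coord (Fp L) L (IsCMField.complexConj L) (complexConj_imagUnit L) v y))) * g)) μF ∧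
          N₁ s g = (lF (Fp L) L v χv (2 * s + 1))⁻¹ * ∫ y, G s (FrameTransport.frameConj (Fp L) L (IsCMField.complexConj L) v (2 + 2) (hermD_eq_map_gramD L e dV hdV dW hdW) (antidiagonal_over_eq_map (Fp L) L 2) Q hQ (toLocalFour (Fp L) L (IsCMField.complexConj L) v (weylTwo (UnitaryGroup.LocalRing L v) (UnitaryGroup.conjLocal L (IsCMField.complexConj L) v))) * FrameTransport.frameConj (Fp L) L (IsCMField.complexConj L) v (2 + 2) (hermD_eq_map_gramD L e dV hdV dW hdW) (antidiagonal_over_eq_map (Fp L) L 2) Q hQ (toLocalFour (Fp L) L (IsCMField.complexConj L) v (uLongTwo (UnitaryGroup.LocalRing L v) (UnitaryGroup.conjLocal L (IsCMField.complexConj L) v) (UnitaryGroup.toLocalRing L v y * algebraMap L (UnitaryGroup.LocalRing L v) (imagUnit L)) (conjLocal_coord (Fp L) L (IsCMField.complexConj L) (complexConj_imagUnit L) v y))) * g) ∂μF) ∧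
        (haveI : Algebra.IsQuadraticExtension (Fp L) L := IsCMField.isQuadraticExtension L
          ∀ h : UnitaryGroup.localPi L (IsCMField.complexConj L) (2 + 2) (hermD L e dV hdV dW hdW) v, ∃ k₀ : ℕ, ∀ s₀ : ℂ, 0 < s₀.re → ∀ k : ℕ, k₀ ≤ k →
          Gn s₀ h = cW s₀ * ∫ x in primePowBall (v.adicCompletion (Fp L)) (-(k : ℤ)),
            conj ((adeleAddCharAt (Fp L) v (-(algebraMap (Fp L) (v.adicCompletion (Fp L)) (gramR L e dV hdV dW hdW 1 1 * Algebra.trace (Fp L) L (σ * imagUnit L))) * x) : ℂ)) * N₂ s₀ (FrameTransport.frameConj (Fp L) L (IsCMField.complexConj L) v (2 + 2) (hermD_eq_map_gramD L e dV hdV dW hdW) (antidiagonal_over_eq_map (Fp L) L 2) Q hQ (toLocalFour (Fp L) L (IsCMField.complexConj L) v (weylTwo (UnitaryGroup.LocalRing L v) (UnitaryGroup.conjLocal L (IsCMField.complexConj L) v))) * FrameTransport.frameConj (Fp L) L (IsCMField.complexConj L) v (2 + 2) (hermD_eq_map_gramD L e dV hdV dW hdW) (antidiagonal_over_eq_map (Fp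 L) L 2) Q hQ (toLocalFour (Fp L) L (IsCMField.complexConj L) v (uLongTwo (UnitaryGroup.LocalRing L v) (UnitaryGroup.conjLocal L (IsCMField.complexConj L) v) (UnitaryGroup.toLocalRing L v x * algebraMap L (UnitaryGroup.LocalRing L v) (imagUnit L)) (conjLocal_coord (Fp L) L (IsCMField.complexConj L) (complexConj_imagUnit L) v x))) * h) ∂μF) := by
  rw [evalPlace_finPart_weylDelta]
  exact twistedLocalFace_of_eq_unipDeltaLocal_ball L e dV hdV hdV0 dW hdW hdW0 v (unipDeltaLoc_eq_unipDeltaLocal L e dV hdV dW hdW v) ν χv hχ K₀ hK₀ hIw G hSieg hsm hflat σ hτ μF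

end CM
end Summit.HodgeConjecture.HodgeConjecture.Cruxes.HLiu418.K2LiuKindOneSingularLocalFaceBall
end
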